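import Mathlib
import HarnessLib
import Summits.ValiantsHypothesis.ValiantsHypothesis.Theses.NewtonUnitEquations
import Summits.ValiantsHypothesis.ValiantsHypothesis.Theorems.NewtonTauWeak.Negative.LoadBearing
import Literature.Computability.AlgebraicComplexity.NewtonPolygonTau

/-!
# Route NewtonUnitEquations — the support item `FewProductsBound` (stmt-ValiantsHypothesis-16052)
# is EQUIVALENT to the crux `NewtonTauWeak`: padding products with unit factors

Support file (prover, item stmt-ValiantsHypothesis-16052) for the "few-products regime" R2 of the
regime split `NewtonTauWeak ↔ LogFactorBound ∧ FewProductsBound` filed by the crux strategist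
(crux evidence `Cruxes/NewtonTauWeak/RegimeSplit.lean`, items stmt-ValiantsHypothesis-16048 = R1,
stmt-ValiantsHypothesis-16052 = R2):

* R2 `FewProductsBound`: `∃ a b, ∀ k m t f, k ≤ 2 ^ m → (t-sparse) → #vert ≤ 2 ^ (a * m) * (t + 2) ^ b`;
* R1 `LogFactorBound`: `∃ b, ∀ k m t f, m ≤ Nat.log 2 k → (t-sparse) → #vert ≤ (k * t + 2) ^ b`;
* crux `NewtonTauWeak` (KPTT arXiv:1308.2286, the weak form after Thm 1; Literature
  `KPTT.newtonTauWeak`, `[status: open]`): `∃ a b, ∀ k m t f, (t-sparse) → #vert ≤ 2^(a m) (k t + 2)^b`.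

## What is proved here (sorry-free, elementary)

The split is DEGENERATE: each half alone is already equivalent to the whole crux.

* `newtonTauWeak_of_fewProductsBound` (the new observation): R2 → `NewtonTauWeak`.  Given any
  `f : Fin k → Fin m → ℂ[X,Y]`, PAD EVERY PRODUCT WITH `n := ⌊log₂ k⌋ + 1` EXTRA FACTORS EQUAL TO `1`
  (`Fin.append (f i) 1`): the polynomial `Σ_i Π_j f_ij` is unchanged (`sum_prod_append_one`), every
  factor is still `t`-sparse as soon as `t ≥ 1` (`#supp 1 = 1`), and now `k < 2^n ≤ 2^(m+n)`, so R2
  applies with `m + n` factors and gives `#vert ≤ 2^(a(m+n)) (t+2)^b ≤ 2^(a m) (k t + 2)^(2a+b)`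
  (`2^n ≤ 2k ≤ (kt+2)²`, `t + 2 ≤ kt + 2`).  The cases `t = 0` (every factor is `0`, the sum is a
  constant, `≤ 1` vertex) and `k = 0` (empty sum) are separate one-liners.
* `fewProductsBound_of_newtonTauWeak`: the converse (`k t + 2 ≤ 2^m (t + 2)`), as in RegimeSplit.
* `fewProductsBound_iff_newtonTauWeak`, `fewProductsBound_iff_kptt_newtonTauWeak`: R2 ↔ crux ↔
  Literature `KPTT.newtonTauWeak` (an OPEN conjecture as printed: KPTT §5; Chatterjee–Gajjar–Tengse
  2023, Conj. 1.3).
* `newtonTauWeak_of_logFactorBound` / `logFactorBound_of_newtonTauWeak` /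
  `logFactorBound_iff_newtonTauWeak`: the same for R1, padding with `2^m` ZERO PRODUCTS instead
  (`Fin.append f 0`; for `m ≥ 1` a product containing a zero factor vanishes, `sum_prod_append_zero`).
* `fewProductsBound_iff_logFactorBound`: hence R1 ↔ R2.
* `newtonTauWeak_iff_twoPowProducts` (§4): the `k`-free normal form of the crux — it is equivalent to
  the two-parameter statement about sums of EXACTLY `2^m` products of `m` `t`-sparse factors
  (`k ≤ 2^m` padded to `2^m` by zero products, `sum_prod_pad_products`).

Consequence for the ledger: stmt-16052 (and stmt-16048) can be settled only by settling the crux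
stmt-ValiantsHypothesis-5904 itself; in particular R2 is not a cheaper "refutation surface" than the
crux — any refutation of R2 is verbatim a refutation of KPTT's weak conjecture, and conversely a
proof of the crux closes R2 by `fewProductsBound_of_newtonTauWeak`.

No definitions, no named facts; `vert`, `vert_le_card_support`, `vert_sum_fin_zero` are the crux's literal
vertex count and its corner lemmas from `Theorems/NewtonTauWeak/Negative/{Zonogon,LoadBearing}.lean`.
-/

-- `<Problem> = <Summit>` for this single-conjunct summit: every decl is `Summit.ValiantsHypothesis.ValiantsHypothesis.…`
-- by the layout (D-0017), which the dupNamespace linter flags; the lakefile sets the same option tree-wide.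
set_option linter.dupNamespace false

namespace Summit.ValiantsHypothesis.ValiantsHypothesis.Theorems.NewtonUnitEquationsFewProductsBound

open scoped BigOperators
open MvPolynomial
open Summit.ValiantsHypothesis.ValiantsHypothesis.Theses.NewtonUnitEquations (NewtonTauWeak)
open Summit.ValiantsHypothesis.ValiantsHypothesis.Theorems.NewtonTauWeak.Negative
  (vert vert_le_card_support vert_sum_fin_zero)

/-! ## §1 Padding lemmas -/

/-- Padding every product with `n` extra factors equal to `1` does not change `Σ_i Π_j f_ij`. -/
theorem sum_prod_append_one {k m : ℕ} (n : ℕ) (f : Fin k → Fin m → MvPolynomial (Fin 2) ℂ) :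
    (∑ i, ∏ j, Fin.append (f i) (fun _ : Fin n => (1 : MvPolynomial (Fin 2) ℂ)) j) =
      ∑ i, ∏ j, f i j := by
  refine Finset.sum_congr rfl fun i _ => ?_
  rw [Fin.prod_univ_add]
  simp only [Fin.append_left, Fin.append_right, Finset.prod_const_one, mul_one]

/-- The padded factors are still `t`-sparse when `1 ≤ t` (the new factors are the constant `1`,
whose support is `{0}`). -/
theorem card_support_append_one_le {k m t : ℕ} (n : ℕ) (f : Fin k → Fin m → MvPolynomial (Fin 2) ℂ)
    (hf : ∀ i j, (f i j).support.card ≤ t) (ht : 1 ≤ t) (i : Fin k) (j : Fin (m + n)) :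
    (Fin.append (f i) (fun _ : Fin n => (1 : MvPolynomial (Fin 2) ℂ)) j).support.card ≤ t := by
  refine Fin.addCases (fun j => ?_) (fun j => ?_) j
  · simpa only [Fin.append_left] using hf i j
  · simp only [Fin.append_right, MvPolynomial.support_one, Finset.card_singleton]
    exact ht

/-- Padding the list of products with `n` ZERO products does not change `Σ_i Π_j f_ij` when every
product has at least one factor (`0 < m`; for `m = 0` the empty product is `1`, not `0`). -/
theorem sum_prod_append_zero {k m : ℕ} (hm : 0 < m) (n : ℕ)
    (f : Fin k → Fin m → MvPolynomial (Fin 2) ℂ) :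
    (∑ i, ∏ j, Fin.append f (fun (_ : Fin n) (_ : Fin m) => (0 : MvPolynomial (Fin 2) ℂ)) i j) =
      ∑ i, ∏ j, f i j := by
  rw [Fin.sum_univ_add]
  simp only [Fin.append_left, Fin.append_right]
  have hz : (∏ _j : Fin m, (0 : MvPolynomial (Fin 2) ℂ)) = 0 :=
    Finset.prod_eq_zero (Finset.mem_univ (⟨0, hm⟩ : Fin m)) rfl
  rw [hz, Finset.sum_const_zero, add_zero]

/-- The zero-padded products consist of `t`-sparse factors (the new factors are `0`). -/
theorem card_support_append_zero_le {k m t : ℕ} (n : ℕ)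
    (f : Fin k → Fin m → MvPolynomial (Fin 2) ℂ) (hf : ∀ i j, (f i j).support.card ≤ t)
    (i : Fin (k + n)) (j : Fin m) :
    (Fin.append f (fun (_ : Fin n) (_ : Fin m) => (0 : MvPolynomial (Fin 2) ℂ)) i j).support.card
      ≤ t := by
  refine Fin.addCases (fun i => ?_) (fun i => ?_) i
  · simpa only [Fin.append_left] using hf i j
  · simp only [Fin.append_right, MvPolynomial.support_zero, Finset.card_empty]
    exact Nat.zero_le _

/-- Sparsity `t = 0`: every factor is `0`, so `Σ_i Π_j f_ij` is a constant (`0`, or `k` when `m = 0`)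
and its Newton polygon has at most one vertex. -/
theorem vert_le_one_of_forall_eq_zero {k m : ℕ} (f : Fin k → Fin m → MvPolynomial (Fin 2) ℂ)
    (hf : ∀ i j, f i j = 0) : vert (∑ i, ∏ j, f i j) ≤ 1 := by
  classical
  have hsub : (∑ i, ∏ j, f i j).support ⊆ {0} := by
    refine MvPolynomial.support_sum.trans (Finset.biUnion_subset.mpr fun i _ => ?_)
    rcases Nat.eq_zero_or_pos m with rfl | hmpos
    · simp
    · have hz : ∏ j, f i j = 0 := Finset.prod_eq_zero (Finset.mem_univ ⟨0, hmpos⟩) (hf i _)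
      simp [hz]
  calc vert (∑ i, ∏ j, f i j) ≤ (∑ i, ∏ j, f i j).support.card := vert_le_card_support _
    _ ≤ ({0} : Finset (Fin 2 →₀ ℕ)).card := Finset.card_le_card hsub
    _ = 1 := Finset.card_singleton _

/-- Sparsity hypothesis `≤ 0` forces every factor to be the zero polynomial. -/
theorem forall_eq_zero_of_card_support_le_zero {k m : ℕ}
    (f : Fin k → Fin m → MvPolynomial (Fin 2) ℂ) (hf : ∀ i j, (f i j).support.card ≤ 0) :
    ∀ i j, f i j = 0 := fun i j => by
  have h0 := hf i j
  rwa [Nat.le_zero, Finset.card_eq_zero, MvPolynomial.support_eq_empty] at h0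

/-! ## §2 R2 (`FewProductsBound`) ↔ crux -/

/-- **R2 ⇒ crux (padding with unit factors).** If sums of `k ≤ 2^m` products of `m` `t`-sparse
bivariate polynomials have `≤ 2^(a m) (t+2)^b` Newton vertices, then ALL sums of `k` products of `m`
`t`-sparse polynomials have `≤ 2^(a m) (k t + 2)^(2a+b)` vertices, i.e. `NewtonTauWeak` holds: pad each
product with `⌊log₂ k⌋ + 1` factors equal to `1`. So the support item stmt-ValiantsHypothesis-16052 is
as strong as the crux stmt-ValiantsHypothesis-5904 (KPTT's weak Newton-polygon τ-conjecture, open). -/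
theorem newtonTauWeak_of_fewProductsBound
    (h : ∃ a b : ℕ, ∀ (k m t : ℕ) (f : Fin k → Fin m → MvPolynomial (Fin 2) ℂ), k ≤ 2 ^ m →
      (∀ i j, (f i j).support.card ≤ t) →
        (Set.extremePoints ℝ (convexHull ℝ ((fun e : Fin 2 →₀ ℕ => fun i : Fin 2 => ((e i : ℕ) : ℝ)) ''
          ((∑ i, ∏ j, f i j).support : Set (Fin 2 →₀ ℕ))))).ncard ≤ 2 ^ (a * m) * (t + 2) ^ b) :
    NewtonTauWeak := by
  obtain ⟨a, b, h⟩ := h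
  refine ⟨a, 2 * a + b, ?_⟩
  intro k m t f hf
  have hpos : 1 ≤ 2 ^ (a * m) * (k * t + 2) ^ (2 * a + b) :=
    Nat.one_le_iff_ne_zero.mpr (by positivity)
  rcases Nat.eq_zero_or_pos t with rfl | htpos
  · -- `t = 0`: every factor vanishes, the sum is a constant
    calc _ = vert (∑ i, ∏ j, f i j) := rfl
      _ ≤ 1 := vert_le_one_of_forall_eq_zero f (forall_eq_zero_of_card_support_le_zero f hf)
      _ ≤ _ := hpos
  rcases Nat.eq_zero_or_pos k with rfl | hkpos
  · -- `k = 0`: empty sum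
    calc _ = vert (∑ i, ∏ j, f i j) := rfl
      _ = 0 := vert_sum_fin_zero m f
      _ ≤ _ := Nat.zero_le _
  -- main case: pad every product with `n` unit factors, `k < 2 ^ n`
  set n : ℕ := Nat.log 2 k + 1 with hn
  have hkn : k ≤ 2 ^ (m + n) :=
    calc k ≤ 2 ^ n := (Nat.lt_pow_succ_log_self one_lt_two k).le
      _ ≤ 2 ^ (m + n) := Nat.pow_le_pow_right (by norm_num) (Nat.le_add_left n m)
  have H := h k (m + n) t (fun i => Fin.append (f i) (fun _ : Fin n => (1 : MvPolynomial (Fin 2) ℂ)))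
    hkn (card_support_append_one_le n f hf htpos)
  rw [sum_prod_append_one n f] at H
  refine H.trans ?_
  -- arithmetic: `2^(a(m+n)) (t+2)^b ≤ 2^(a m) (kt+2)^(2a+b)`
  have h2n : 2 ^ n ≤ (k * t + 2) ^ 2 := by
    have h1 : 2 ^ n ≤ 2 * k := by
      rw [hn, pow_succ]
      have := Nat.pow_log_le_self 2 hkpos.ne'
      omega
    have hkt : k ≤ k * t := Nat.le_mul_of_pos_right k htpos
    have h2 : 2 * k ≤ 4 * (k * t) + 4 := by linarith [hkt]
    have h3 : 4 * (k * t) + 4 ≤ (k * t + 2) ^ 2 := by nlinarith [sq_nonneg (k * t)]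
    exact h1.trans (h2.trans h3)
  have ht2 : t + 2 ≤ k * t + 2 := by nlinarith
  calc 2 ^ (a * (m + n)) * (t + 2) ^ b = 2 ^ (a * m) * (2 ^ n) ^ a * (t + 2) ^ b := by
        rw [mul_add, pow_add, mul_comm a n, pow_mul (2 : ℕ) n a]
    _ ≤ 2 ^ (a * m) * ((k * t + 2) ^ 2) ^ a * (k * t + 2) ^ b :=
        Nat.mul_le_mul (Nat.mul_le_mul_left _ (Nat.pow_le_pow_left h2n _))
          (Nat.pow_le_pow_left ht2 _)
    _ = 2 ^ (a * m) * (k * t + 2) ^ (2 * a + b) := by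
        rw [← pow_mul, mul_assoc, ← pow_add]

/-- **Crux ⇒ R2** (the easy half, as in the strategist's RegimeSplit `subs_of_newtonTauWeak`): under
`k ≤ 2^m`, `k t + 2 ≤ 2^m (t + 2)`, so `2^(a m)(k t+2)^b ≤ 2^((a+b) m)(t+2)^b`. -/
theorem fewProductsBound_of_newtonTauWeak (h : NewtonTauWeak) :
    ∃ a b : ℕ, ∀ (k m t : ℕ) (f : Fin k → Fin m → MvPolynomial (Fin 2) ℂ), k ≤ 2 ^ m →
      (∀ i j, (f i j).support.card ≤ t) →
        (Set.extremePoints ℝ (convexHull ℝ ((fun e : Fin 2 →₀ ℕ => fun i : Fin 2 => ((e i : ℕ) : ℝ)) ''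
          ((∑ i, ∏ j, f i j).support : Set (Fin 2 →₀ ℕ))))).ncard ≤ 2 ^ (a * m) * (t + 2) ^ b := by
  obtain ⟨a, b, h⟩ := h
  refine ⟨a + b, b, ?_⟩
  intro k m t f hk hf
  have hkt : k * t + 2 ≤ 2 ^ m * (t + 2) := by
    have h1 : 1 ≤ 2 ^ m := Nat.one_le_two_pow
    have : k * t ≤ 2 ^ m * t := Nat.mul_le_mul_right _ hk
    nlinarith
  calc _ ≤ 2 ^ (a * m) * (k * t + 2) ^ b := h k m t f hf
    _ ≤ 2 ^ (a * m) * (2 ^ m * (t + 2)) ^ b := Nat.mul_le_mul_left _ (Nat.pow_le_pow_left hkt _)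
    _ = 2 ^ ((a + b) * m) * (t + 2) ^ b := by
        rw [mul_pow, ← pow_mul, ← mul_assoc, ← pow_add]; ring_nf

/-- **R2 ↔ crux.** The support item `FewProductsBound` (stmt-ValiantsHypothesis-16052, verbatim on
the left) is equivalent to the crux `NewtonTauWeak` (stmt-ValiantsHypothesis-5904). -/
theorem fewProductsBound_iff_newtonTauWeak :
    (∃ a b : ℕ, ∀ (k m t : ℕ) (f : Fin k → Fin m → MvPolynomial (Fin 2) ℂ), k ≤ 2 ^ m →
      (∀ i j, (f i j).support.card ≤ t) →
        (Set.extremePoints ℝ (convexHull ℝ ((fun e : Fin 2 →₀ ℕ => fun i : Fin 2 => ((e i : ℕ) : ℝ)) ''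
          ((∑ i, ∏ j, f i j).support : Set (Fin 2 →₀ ℕ))))).ncard ≤ 2 ^ (a * m) * (t + 2) ^ b) ↔
    NewtonTauWeak :=
  ⟨newtonTauWeak_of_fewProductsBound, fewProductsBound_of_newtonTauWeak⟩

/-- **R2 ↔ KPTT's weak Newton-polygon τ-conjecture** as recorded in the Literature
(`KPTT.newtonTauWeak`, arXiv:1308.2286, sentence after Thm 1; `[status: open]`): the item is an open
conjecture in disguise. -/
theorem fewProductsBound_iff_kptt_newtonTauWeak :
    (∃ a b : ℕ, ∀ (k m t : ℕ) (f : Fin k → Fin m → MvPolynomial (Fin 2) ℂ), k ≤ 2 ^ m →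
      (∀ i j, (f i j).support.card ≤ t) →
        (Set.extremePoints ℝ (convexHull ℝ ((fun e : Fin 2 →₀ ℕ => fun i : Fin 2 => ((e i : ℕ) : ℝ)) ''
          ((∑ i, ∏ j, f i j).support : Set (Fin 2 →₀ ℕ))))).ncard ≤ 2 ^ (a * m) * (t + 2) ^ b) ↔
    Literature.Computability.AlgebraicComplexity.KPTT.newtonTauWeak :=
  fewProductsBound_iff_newtonTauWeak.trans Iff.rfl

/-! ## §3 R1 (`LogFactorBound`) ↔ crux -/

/-- **R1 ⇒ crux (padding with zero products).** If sums of `k` products of `m ≤ ⌊log₂ k⌋` `t`-sparse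
factors have `≤ (k t + 2)^b` Newton vertices, then `NewtonTauWeak` holds with constants `(b, 2b)`:
for `m ≥ 1` append `2^m` zero products (`m ≤ log₂ (k + 2^m)`, the sum is unchanged) and use
`(k + 2^m) t + 2 ≤ 2^m (k t + 2)²`; `m = 0` is already in the regime, `k = 0` is the empty sum. -/
theorem newtonTauWeak_of_logFactorBound
    (h : ∃ b : ℕ, ∀ (k m t : ℕ) (f : Fin k → Fin m → MvPolynomial (Fin 2) ℂ), m ≤ Nat.log 2 k →
      (∀ i j, (f i j).support.card ≤ t) →
        (Set.extremePoints ℝ (convexHull ℝ ((fun e : Fin 2 →₀ ℕ => fun i : Fin 2 => ((e i : ℕ) : ℝ)) ''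
          ((∑ i, ∏ j, f i j).support : Set (Fin 2 →₀ ℕ))))).ncard ≤ (k * t + 2) ^ b) :
    NewtonTauWeak := by
  obtain ⟨b, h⟩ := h
  refine ⟨b, 2 * b, ?_⟩
  intro k m t f hf
  rcases Nat.eq_zero_or_pos k with rfl | hkpos
  · -- `k = 0`: empty sum
    calc _ = vert (∑ i, ∏ j, f i j) := rfl
      _ = 0 := vert_sum_fin_zero m f
      _ ≤ _ := Nat.zero_le _
  rcases Nat.eq_zero_or_pos m with rfl | hmpos
  · -- `m = 0 ≤ log₂ k`: R1 applies directly
    calc _ ≤ (k * t + 2) ^ b := h k 0 t f (Nat.zero_le _) hf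
      _ ≤ (k * t + 2) ^ (2 * b) := Nat.pow_le_pow_right (by omega) (by omega)
      _ = 2 ^ (b * 0) * (k * t + 2) ^ (2 * b) := by rw [mul_zero, pow_zero, one_mul]
  -- main case: append `2 ^ m` zero products
  have hm : m ≤ Nat.log 2 (k + 2 ^ m) := Nat.le_log_of_pow_le one_lt_two (Nat.le_add_left _ _)
  have H := h (k + 2 ^ m) m t
    (Fin.append f (fun (_ : Fin (2 ^ m)) (_ : Fin m) => (0 : MvPolynomial (Fin 2) ℂ))) hm
    (card_support_append_zero_le (2 ^ m) f hf)
  rw [sum_prod_append_zero hmpos (2 ^ m) f] at H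
  refine H.trans ?_
  have hkey : (k + 2 ^ m) * t + 2 ≤ 2 ^ m * (k * t + 2) ^ 2 := by
    have h1 : 1 ≤ 2 ^ m := Nat.one_le_two_pow
    have e1 : k * t ≤ 2 ^ m * (k * t) := Nat.le_mul_of_pos_left _ (by positivity)
    have e2 : 2 ^ m * t ≤ 2 ^ m * (k * t) := Nat.mul_le_mul_left _ (Nat.le_mul_of_pos_left _ hkpos)
    have e3 : 2 ≤ 2 * 2 ^ m := by linarith [h1]
    have step1 : (k + 2 ^ m) * t + 2 ≤ 2 ^ m * (2 * (k * t) + 2) := by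
      have : (k + 2 ^ m) * t = k * t + 2 ^ m * t := by ring
      rw [this]; linarith [e1, e2, e3]
    have step2 : 2 * (k * t) + 2 ≤ (k * t + 2) ^ 2 := by nlinarith [sq_nonneg (k * t)]
    exact step1.trans (Nat.mul_le_mul_left _ step2)
  calc ((k + 2 ^ m) * t + 2) ^ b ≤ (2 ^ m * (k * t + 2) ^ 2) ^ b := Nat.pow_le_pow_left hkey _
    _ = 2 ^ (b * m) * (k * t + 2) ^ (2 * b) := by
        rw [mul_pow, ← pow_mul, ← pow_mul, mul_comm m b]

/-- **Crux ⇒ R1** (as in the strategist's RegimeSplit `subs_of_newtonTauWeak`): under `m ≤ ⌊log₂ k⌋`,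
`2^(a m) ≤ k^a ≤ (k t + 2)^a`, so the bound becomes `(k t + 2)^(a+b)`; `t = 0` separately. -/
theorem logFactorBound_of_newtonTauWeak (h : NewtonTauWeak) :
    ∃ b : ℕ, ∀ (k m t : ℕ) (f : Fin k → Fin m → MvPolynomial (Fin 2) ℂ), m ≤ Nat.log 2 k →
      (∀ i j, (f i j).support.card ≤ t) →
        (Set.extremePoints ℝ (convexHull ℝ ((fun e : Fin 2 →₀ ℕ => fun i : Fin 2 => ((e i : ℕ) : ℝ)) ''
          ((∑ i, ∏ j, f i j).support : Set (Fin 2 →₀ ℕ))))).ncard ≤ (k * t + 2) ^ b := by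
  obtain ⟨a, b, h⟩ := h
  refine ⟨a + b, ?_⟩
  intro k m t f hm hf
  have hbase : 1 ≤ k * t + 2 := by omega
  rcases Nat.eq_zero_or_pos t with rfl | htpos
  · calc _ = vert (∑ i, ∏ j, f i j) := rfl
      _ ≤ 1 := vert_le_one_of_forall_eq_zero f (forall_eq_zero_of_card_support_le_zero f hf)
      _ ≤ (k * 0 + 2) ^ (a + b) := Nat.one_le_pow _ _ (by omega)
  have h2m : 2 ^ (a * m) ≤ (k * t + 2) ^ a := by
    rcases Nat.eq_zero_or_pos k with rfl | hkpos
    · have : m = 0 := by simpa using hm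
      subst this; simp [Nat.one_le_pow]
    · have hkk : k ≤ k * t + 2 := by nlinarith
      calc 2 ^ (a * m) = (2 ^ m) ^ a := by rw [mul_comm, pow_mul]
        _ ≤ (2 ^ Nat.log 2 k) ^ a := Nat.pow_le_pow_left (Nat.pow_le_pow_right (by norm_num) hm) _
        _ ≤ k ^ a := Nat.pow_le_pow_left (Nat.pow_log_le_self 2 hkpos.ne') _
        _ ≤ (k * t + 2) ^ a := Nat.pow_le_pow_left hkk _
  calc _ ≤ 2 ^ (a * m) * (k * t + 2) ^ b := h k m t f hf
    _ ≤ (k * t + 2) ^ a * (k * t + 2) ^ b := Nat.mul_le_mul_right _ h2m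
    _ = (k * t + 2) ^ (a + b) := (pow_add _ _ _).symm

/-- **R1 ↔ crux.** The support item `LogFactorBound` (stmt-ValiantsHypothesis-16048, verbatim on the
left) is equivalent to the crux `NewtonTauWeak` (stmt-ValiantsHypothesis-5904). -/
theorem logFactorBound_iff_newtonTauWeak :
    (∃ b : ℕ, ∀ (k m t : ℕ) (f : Fin k → Fin m → MvPolynomial (Fin 2) ℂ), m ≤ Nat.log 2 k →
      (∀ i j, (f i j).support.card ≤ t) →
        (Set.extremePoints ℝ (convexHull ℝ ((fun e : Fin 2 →₀ ℕ => fun i : Fin 2 => ((e i : ℕ) : ℝ)) ''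
          ((∑ i, ∏ j, f i j).support : Set (Fin 2 →₀ ℕ))))).ncard ≤ (k * t + 2) ^ b) ↔
    NewtonTauWeak :=
  ⟨newtonTauWeak_of_logFactorBound, logFactorBound_of_newtonTauWeak⟩

/-- **The regime split is degenerate: R2 ↔ R1.** Both "halves" of
`NewtonTauWeak ↔ LogFactorBound ∧ FewProductsBound` are each equivalent to the crux, hence to each
other. -/
theorem fewProductsBound_iff_logFactorBound :
    (∃ a b : ℕ, ∀ (k m t : ℕ) (f : Fin k → Fin m → MvPolynomial (Fin 2) ℂ), k ≤ 2 ^ m →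
      (∀ i j, (f i j).support.card ≤ t) →
        (Set.extremePoints ℝ (convexHull ℝ ((fun e : Fin 2 →₀ ℕ => fun i : Fin 2 => ((e i : ℕ) : ℝ)) ''
          ((∑ i, ∏ j, f i j).support : Set (Fin 2 →₀ ℕ))))).ncard ≤ 2 ^ (a * m) * (t + 2) ^ b) ↔
    (∃ b : ℕ, ∀ (k m t : ℕ) (f : Fin k → Fin m → MvPolynomial (Fin 2) ℂ), m ≤ Nat.log 2 k →
      (∀ i j, (f i j).support.card ≤ t) →
        (Set.extremePoints ℝ (convexHull ℝ ((fun e : Fin 2 →₀ ℕ => fun i : Fin 2 => ((e i : ℕ) : ℝ)) ''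
          ((∑ i, ∏ j, f i j).support : Set (Fin 2 →₀ ℕ))))).ncard ≤ (k * t + 2) ^ b) :=
  fewProductsBound_iff_newtonTauWeak.trans logFactorBound_iff_newtonTauWeak.symm

/-! ## §4 The `k`-free normal form of the crux: exactly `2 ^ m` products -/

/-- Padding the list of `k ≤ K` products with zero products up to exactly `K` products (entry `i` is
`f i` for `i < k` and the zero row otherwise) does not change `Σ_i Π_j f_ij` when `0 < m`. -/
theorem sum_prod_pad_products {k K m : ℕ} (hk : k ≤ K) (hm : 0 < m)
    (f : Fin k → Fin m → MvPolynomial (Fin 2) ℂ) :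
    (∑ i : Fin K, ∏ j, (if h : (i : ℕ) < k then f ⟨i, h⟩ j else (0 : MvPolynomial (Fin 2) ℂ))) =
      ∑ i, ∏ j, f i j := by
  classical
  rw [← Finset.sum_subset
    (Finset.subset_univ ((Finset.univ : Finset (Fin k)).map (Fin.castLEEmb hk)))]
  · rw [Finset.sum_map]
    refine Finset.sum_congr rfl fun i _ => Finset.prod_congr rfl fun j _ => ?_
    simp [Fin.castLEEmb_apply, Fin.is_lt]
  · intro x _ hx
    have hxk : ¬ ((x : ℕ) < k) := fun hlt =>
      hx (Finset.mem_map.mpr ⟨⟨x, hlt⟩, Finset.mem_univ _, Fin.ext rfl⟩)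
    simp only [hxk, dif_neg, not_false_eq_true]
    exact Finset.prod_eq_zero (Finset.mem_univ (⟨0, hm⟩ : Fin m)) rfl

/-- The zero-padded list of products consists of `t`-sparse factors. -/
theorem card_support_pad_products_le {k K m t : ℕ}
    (f : Fin k → Fin m → MvPolynomial (Fin 2) ℂ) (hf : ∀ i j, (f i j).support.card ≤ t)
    (i : Fin K) (j : Fin m) :
    (if h : (i : ℕ) < k then f ⟨i, h⟩ j else (0 : MvPolynomial (Fin 2) ℂ)).support.card ≤ t := by
  split_ifs with h
  · exact hf _ _
  · simp

/-- **`2^m` products ⇒ crux.** If sums of EXACTLY `2^m` products of `m` `t`-sparse bivariate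
polynomials have `≤ 2^(a m) (t+2)^b` Newton vertices, then `NewtonTauWeak` holds: for `m ≥ 1` pad
`k ≤ 2^m` products with zero products to exactly `2^m` (`sum_prod_pad_products`) and conclude by
`newtonTauWeak_of_fewProductsBound`; for `m = 0` the sum is the constant `k`, `≤ 1` vertex. -/
theorem newtonTauWeak_of_twoPowProducts
    (h : ∃ a b : ℕ, ∀ (m t : ℕ) (f : Fin (2 ^ m) → Fin m → MvPolynomial (Fin 2) ℂ),
      (∀ i j, (f i j).support.card ≤ t) →
        (Set.extremePoints ℝ (convexHull ℝ ((fun e : Fin 2 →₀ ℕ => fun i : Fin 2 => ((e i : ℕ) : ℝ)) ''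
          ((∑ i, ∏ j, f i j).support : Set (Fin 2 →₀ ℕ))))).ncard ≤ 2 ^ (a * m) * (t + 2) ^ b) :
    NewtonTauWeak := by
  obtain ⟨a, b, h⟩ := h
  refine newtonTauWeak_of_fewProductsBound ⟨a, b, ?_⟩
  intro k m t f hk hf
  rcases Nat.eq_zero_or_pos m with rfl | hmpos
  · -- `m = 0`: empty products, the sum is the constant `k`
    calc _ = vert (∑ i, ∏ j, f i j) := rfl
      _ ≤ 1 := vert_le_one_of_forall_eq_zero f (fun i j => j.elim0)
      _ ≤ 2 ^ (a * 0) * (t + 2) ^ b := Nat.one_le_iff_ne_zero.mpr (by positivity)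
  · have H := h m t (fun i j => if h : (i : ℕ) < k then f ⟨i, h⟩ j else 0)
      (card_support_pad_products_le f hf)
    rwa [sum_prod_pad_products hk hmpos f] at H

/-- **Crux ⇒ `2^m` products** (the instance `k = 2^m` of `fewProductsBound_of_newtonTauWeak`). -/
theorem twoPowProducts_of_newtonTauWeak (h : NewtonTauWeak) :
    ∃ a b : ℕ, ∀ (m t : ℕ) (f : Fin (2 ^ m) → Fin m → MvPolynomial (Fin 2) ℂ),
      (∀ i j, (f i j).support.card ≤ t) →
        (Set.extremePoints ℝ (convexHull ℝ ((fun e : Fin 2 →₀ ℕ => fun i : Fin 2 => ((e i : ℕ) : ℝ)) ''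
          ((∑ i, ∏ j, f i j).support : Set (Fin 2 →₀ ℕ))))).ncard ≤ 2 ^ (a * m) * (t + 2) ^ b := by
  obtain ⟨a, b, h⟩ := fewProductsBound_of_newtonTauWeak h
  exact ⟨a, b, fun m t f hf => h (2 ^ m) m t f le_rfl hf⟩

/-- **The `k`-free normal form of the crux.** `NewtonTauWeak` (three parameters `k, m, t`) is
equivalent to the two-parameter statement: sums of exactly `2^m` products of `m` `t`-sparse bivariate
complex polynomials have `2^(O(m)) · t^(O(1))` Newton vertices.  (Both paddings at work: zero products
for `k`, unit factors for `m`.) -/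
theorem newtonTauWeak_iff_twoPowProducts :
    NewtonTauWeak ↔
    ∃ a b : ℕ, ∀ (m t : ℕ) (f : Fin (2 ^ m) → Fin m → MvPolynomial (Fin 2) ℂ),
      (∀ i j, (f i j).support.card ≤ t) →
        (Set.extremePoints ℝ (convexHull ℝ ((fun e : Fin 2 →₀ ℕ => fun i : Fin 2 => ((e i : ℕ) : ℝ)) ''
          ((∑ i, ∏ j, f i j).support : Set (Fin 2 →₀ ℕ))))).ncard ≤ 2 ^ (a * m) * (t + 2) ^ b :=
  ⟨twoPowProducts_of_newtonTauWeak, newtonTauWeak_of_twoPowProducts⟩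

end Summit.ValiantsHypothesis.ValiantsHypothesis.Theorems.NewtonUnitEquationsFewProductsBound
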